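import Mathlib
import HarnessLib
import HarnessLib.Audit
import Summits.HodgeConjecture.HodgeConjecture.Theses.KleimanBFSeeds
import Literature.AlgebraicGeometry.HodgeTheory.ChernCharacterBetti
import Literature.AlgebraicGeometry.HodgeTheory.ChernCharacterBettiSums
import Literature.AlgebraicGeometry.HodgeTheory.KleimanChernNormalForm
import Literature.AlgebraicGeometry.KTheory.GrothendieckGroup
import Summits.HodgeConjecture.HodgeConjecture.Theorems.KleimanBFSeedsKleimanChernCharacterOnBettiStubEffectivise
import Summits.HodgeConjecture.HodgeConjecture.Theorems.KleimanBFSeedsKleimanChernCharacterOnBettiStubVirtualComplementsOfNonempty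
import Literature.AlgebraicGeometry.KTheory.ChernCharacterPresentsAlgebraicClasses

/-!
# Skeleton `Lines/birth` for crux `KleimanChernCharacterOnBetti` (stmt-HodgeConjecture-26526)

HONEST FRAMING: a crux PROOF SKELETON (cruxes-workfile class), not a proof: the construction crux
K-C⁺ (`∃ C : ChernCharacterBetti, C.KleimanChernNormalForm`) is NOT proved here; the load-bearing
stub `stub_virtualComplements` (existence of a Chern character ON BETTI COHOMOLOGY with the
sum-normalised virtual normal form and h-trivial complements — the GRR/`cl ∘ ch` instance, typing
debt XL shared with stmt-HodgeConjecture-19780) is `sorry`. Nothing toward K2, H2, HC_AV, HC_CM, HC.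

Provenance. Lead prover's RE-PUBLICATION (unit `leafhand-hodge-kleimanbf-1-g0`, 2026-08-30) of the
planner's registered BC3 birth skeleton (hodge-idea-1 g6, sha16 e438c6dcc976044c, stubs
`stub_virtualComplements` [L, load-bearing] / `stub_effectivise` [M, bookkeeping]), whose file is
not mounted in a prover jail; the two auxiliary predicates are RECONSTRUCTED from the line card
(ideators/hodge-idea-1 INBOX l.58): «(SVNF) sum-normalised VIRTUAL normal form — ∀ rational algebraic
x of codim p ≥ 1 ∃ v (a formal ℤ-combination of finite locally free modules) with chVirtual_p(v) =
c_p·hᵖ + N·x, N ≠ 0, chVirtual_i(v) = c_i·hⁱ (0<i<p) — and (HTC) h-trivial complements — ∀ f.l.f.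
E ∃ f.l.f. K, ch_i(E)+ch_i(K) ∈ ℚ·hⁱ ∀ i ≥ 1»; here a virtual combination is a pair of LISTS
(positive part `Lp`, negative part `Lm`; repetitions encode multiplicities), which is the form the
tree's list bookkeeping (`isFiniteLocallyFree_foldr_biprod`, `ChernCharacterBetti.ch_foldr_biprod`)
consumes directly.

* `stub_virtualComplements : ∃ C, SumVirtualNormalForm C ∧ HTrivialComplements C` — OPEN (the
  construction: intended witness `cl ∘ ch`; SVNF from `ch : K⁰(X)_ℚ ⥲ CH(X)_ℚ` (Fulton 15.2.16 (b)) +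
  Kleiman 1969 §5, HTC from Serre's theorem A: `0 → K → ⊕𝒪(−m) → E^∨… `, resp. `E` a quotient of
  `⊕ 𝒪(−m)` with finite locally free kernel `K`, `ch(⊕𝒪(−m)) ∈ ℚ[h]`).
* `stub_effectivise : ∀ C, SumVirtualNormalForm C → HTrivialComplements C → C.KleimanChernNormalForm`
  — bookkeeping valid for EVERY `C`: replace each negative term `−[F]` by `+[K_F]` (an h-trivial
  complement) and take the list direct sum; `chᵢ` changes by a rational multiple of `hⁱ` only.
  LANDED as a Theorems helper (p781461) and discharged by name below: the registered stub list is now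
  `stub_virtualComplements` alone.

v4 (unit `leafhand-hodge-kleimanbfseeds-1-g0`, 2026-08-30; stub list UNCHANGED): a sorry-free REMARK theorem records
that the open stub is EXACTLY the shared construction item plus one citation —
`stub_virtualComplements_of_chernCharacterOnBetti : Nonempty ChernCharacterBetti →
KTheory.Fulton1998_chernCharacter_presentsAlgebraicClasses → (∃ C, SumVirtualNormalForm C ∧ HTrivialComplements C)`
(landed helper `Theorems.KleimanChernCharacterOnBettiBirth.stub_virtualComplements_of_nonempty`, p793861: for EVERY
`C`, Fulton's presentation fact gives SVNF — one-term virtual combination of the Kleiman bundle — and HTC —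
`K := E' ⊕ E^{⊕(N−1)}` with `E'` presenting `κ = −ch(E)`); the crux BY NAME under the same two hypotheses is the
landed `Theorems.kleimanChernCharacterOnBetti_of_nonempty_chernCharacterBetti` (p793556, not restated here so that
`KleimanChernCharacterOnBetti_of` stays the only theorem of this file concluding the crux). This is not a proof of the
stub: `Nonempty ChernCharacterBetti` is the OPEN construction item stmt-HodgeConjecture-19780 and the Fulton fact an
unproved Literature `def … : Prop`; this matches the director's (K2) re-glue «26526 := 19780 + citation».
* `KleimanChernCharacterOnBetti_of` : stubs ⟹ crux BY NAME.
-/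

-- every declaration of this problem lives in `Summit.HodgeConjecture.HodgeConjecture.…` (summit = sub-problem)
set_option linter.dupNamespace false

noncomputable section

open CategoryTheory CategoryTheory.Limits AlgebraicGeometry
open Literature.AlgebraicGeometry.Motives
open Literature.AlgebraicGeometry.HodgeTheory
open Literature.AlgebraicGeometry.KTheory

namespace Summit.HodgeConjecture.HodgeConjecture.Cruxes.KleimanChernCharacterOnBetti.Birth

/-- **(SVNF) sum-normalised virtual normal form** of a Chern character `C` on Betti cohomology: on
every smooth projective `X ⊆ ℙᴺ` (hyperplane data `e`, `a` rational `≠ 0`, `h = e^*a`), every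
rational algebraic class `x` of codimension `p ≥ 1` is, up to `ℚ·hᵖ` and a non-zero rational factor,
the degree-`p` Chern character of a VIRTUAL combination `Σ[E ∈ Lp] − Σ[F ∈ Lm]` of finite locally
free modules whose lower positive-degree Chern characters lie on the `h`-line. -/
def SumVirtualNormalForm (C : ChernCharacterBetti) : Prop :=
  ∀ ⦃n : ℕ⦄ ⦃X : SchemeOver ℂ⦄, IsSmoothProjective n X →
    ∀ (e : ProjectiveEmbedding X) (a : complexBetti (projectiveSpace e.n ℂ) 2),
      IsRationalClass a → a ≠ 0 →
      ∀ ⦃p : ℕ⦄, 0 < p → ∀ ⦃x : complexBetti X (2 * p)⦄, IsRationalClass x →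
        x ∈ algebraicClasses X p →
        ∃ (Lp Lm : List X.left.Modules) (q N : ℚ) (c : ℕ → ℚ),
          (∀ E ∈ Lp, IsFiniteLocallyFree E) ∧ (∀ F ∈ Lm, IsFiniteLocallyFree F) ∧ N ≠ 0 ∧
          (Lp.map fun E => C.ch X E p).sum - (Lm.map fun F => C.ch X F p).sum =
            (q : ℂ) • cupPowTwo (complexBetti.map e.ι 2 a) p + (N : ℂ) • x ∧
          ∀ i : ℕ, 0 < i → i < p →
            (Lp.map fun E => C.ch X E i).sum - (Lm.map fun F => C.ch X F i).sum =
              (c i : ℂ) • cupPowTwo (complexBetti.map e.ι 2 a) i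

/-- **(HTC) h-trivial complements** for a Chern character `C`: on every smooth projective
`X ⊆ ℙᴺ` (hyperplane data as above), every finite locally free `E` has a finite locally free `K`
with `chᵢ(E) + chᵢ(K) ∈ ℚ·hⁱ` for all `i ≥ 1` (for `cl ∘ ch`: the kernel of a surjection
`⊕ 𝒪(−m) ↠ E`, Serre's theorem A). -/
def HTrivialComplements (C : ChernCharacterBetti) : Prop :=
  ∀ ⦃n : ℕ⦄ ⦃X : SchemeOver ℂ⦄, IsSmoothProjective n X →
    ∀ (e : ProjectiveEmbedding X) (a : complexBetti (projectiveSpace e.n ℂ) 2),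
      IsRationalClass a → a ≠ 0 →
      ∀ (E : X.left.Modules), IsFiniteLocallyFree E →
        ∃ K : X.left.Modules, IsFiniteLocallyFree K ∧
          ∀ i : ℕ, 0 < i → ∃ r : ℚ, C.ch X E i + C.ch X K i = (r : ℂ) • cupPowTwo (complexBetti.map e.ι 2 a) i

/-- **Remark (sorry-free): the stub modulo the shared construction item and Fulton's presentation fact.**
`Nonempty ChernCharacterBetti` (stmt-HodgeConjecture-19780, OPEN) and
`KTheory.Fulton1998_chernCharacter_presentsAlgebraicClasses` (named fact) give the statement of
`stub_virtualComplements` — by the landed helper `Theorems.KleimanChernCharacterOnBettiBirth.stub_virtualComplements_of_nonempty`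
(p793861), whose spelled-out predicates are these `SumVirtualNormalForm` / `HTrivialComplements` verbatim. -/
theorem stub_virtualComplements_of_chernCharacterOnBetti (hCC : Nonempty ChernCharacterBetti)
    (hF : Fulton1998_chernCharacter_presentsAlgebraicClasses) :
    ∃ C : ChernCharacterBetti, SumVirtualNormalForm C ∧ HTrivialComplements C :=
  Summit.HodgeConjecture.HodgeConjecture.Theorems.KleimanChernCharacterOnBettiBirth.stub_virtualComplements_of_nonempty
    hCC hF

/-- STUB (open, load-bearing): the construction — a Chern character on Betti cohomology with the
sum-normalised virtual normal form and h-trivial complements EXISTS. -/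
theorem stub_virtualComplements :
    ∃ C : ChernCharacterBetti, SumVirtualNormalForm C ∧ HTrivialComplements C := by
  sorry

/-- Former stub `stub_effectivise` (bookkeeping, valid for every `C`), DISCHARGED BY NAME by the landed
Theorems helper `Theorems.KleimanChernCharacterOnBettiBirth.stub_effectivise` (p781461,
`Theorems/KleimanBFSeedsKleimanChernCharacterOnBettiStubEffectivise.lean`): `∀ C, SumVirtualNormalForm C →
HTrivialComplements C → C.KleimanChernNormalForm` with both predicates spelled out (fully qualified). -/
theorem stub_effectivise :
    ∀ C : Literature.AlgebraicGeometry.HodgeTheory.ChernCharacterBetti,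
    (∀ ⦃n : ℕ⦄ ⦃X : Literature.AlgebraicGeometry.Motives.SchemeOver ℂ⦄, Literature.AlgebraicGeometry.Motives.IsSmoothProjective n X →
      ∀ (e : Literature.AlgebraicGeometry.Motives.ProjectiveEmbedding X) (a : Literature.AlgebraicGeometry.HodgeTheory.complexBetti (Literature.AlgebraicGeometry.Motives.projectiveSpace e.n ℂ) 2),
        Literature.AlgebraicGeometry.HodgeTheory.IsRationalClass a → a ≠ 0 →
        ∀ ⦃p : ℕ⦄, 0 < p → ∀ ⦃x : Literature.AlgebraicGeometry.HodgeTheory.complexBetti X (2 * p)⦄, Literature.AlgebraicGeometry.HodgeTheory.IsRationalClass x →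
          x ∈ Literature.AlgebraicGeometry.HodgeTheory.algebraicClasses X p →
          ∃ (Lp Lm : List X.left.Modules) (q N : ℚ) (c : ℕ → ℚ),
            (∀ E ∈ Lp, Literature.AlgebraicGeometry.Motives.IsFiniteLocallyFree E) ∧ (∀ F ∈ Lm, Literature.AlgebraicGeometry.Motives.IsFiniteLocallyFree F) ∧ N ≠ 0 ∧
            (Lp.map fun E => C.ch X E p).sum - (Lm.map fun F => C.ch X F p).sum =
              (q : ℂ) • Literature.AlgebraicGeometry.HodgeTheory.cupPowTwo (Literature.AlgebraicGeometry.HodgeTheory.complexBetti.map e.ι 2 a) p + (N : ℂ) • x ∧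
            ∀ i : ℕ, 0 < i → i < p →
              (Lp.map fun E => C.ch X E i).sum - (Lm.map fun F => C.ch X F i).sum =
                (c i : ℂ) • Literature.AlgebraicGeometry.HodgeTheory.cupPowTwo (Literature.AlgebraicGeometry.HodgeTheory.complexBetti.map e.ι 2 a) i) →
    (∀ ⦃n : ℕ⦄ ⦃X : Literature.AlgebraicGeometry.Motives.SchemeOver ℂ⦄, Literature.AlgebraicGeometry.Motives.IsSmoothProjective n X →
      ∀ (e : Literature.AlgebraicGeometry.Motives.ProjectiveEmbedding X) (a : Literature.AlgebraicGeometry.HodgeTheory.complexBetti (Literature.AlgebraicGeometry.Motives.projectiveSpace e.n ℂ) 2),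
        Literature.AlgebraicGeometry.HodgeTheory.IsRationalClass a → a ≠ 0 →
        ∀ (E : X.left.Modules), Literature.AlgebraicGeometry.Motives.IsFiniteLocallyFree E →
          ∃ K : X.left.Modules, Literature.AlgebraicGeometry.Motives.IsFiniteLocallyFree K ∧
            ∀ i : ℕ, 0 < i → ∃ r : ℚ, C.ch X E i + C.ch X K i =
              (r : ℂ) • Literature.AlgebraicGeometry.HodgeTheory.cupPowTwo (Literature.AlgebraicGeometry.HodgeTheory.complexBetti.map e.ι 2 a) i) →
    C.KleimanChernNormalForm :=
  Summit.HodgeConjecture.HodgeConjecture.Theorems.KleimanChernCharacterOnBettiBirth.stub_effectivise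

/-- **Composition**: the two stubs give the crux `KleimanChernCharacterOnBetti` BY NAME (the
signature of `stub_effectivise` is `SumVirtualNormalForm C → HTrivialComplements C → …` with the two
predicates spelled out, so that a Theorems helper can match it textually). The ONLY theorem of this
file concluding the crux. -/
theorem KleimanChernCharacterOnBetti_of :
    Summit.HodgeConjecture.HodgeConjecture.Theses.KleimanBFSeeds.KleimanChernCharacterOnBetti := by
  obtain ⟨C, hS, hH⟩ := stub_virtualComplements
  exact ⟨C, stub_effectivise C hS hH⟩

end Summit.HodgeConjecture.HodgeConjecture.Cruxes.KleimanChernCharacterOnBetti.Birth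

end
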